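import Mathlib.Algebra.Homology.Embedding.CochainComplex
import Literature.AlgebraicGeometry.Crystalline.DeRhamComplexSheaf
import Literature.AlgebraicGeometry.Crystalline.SheafHypercohomology
import HarnessLib

/-!
# Algebraic de Rham cohomology `Hⁿ_dR(X/k) = ℍⁿ(X, Ω•_{X/k})`

Grothendieck's **algebraic de Rham cohomology** of a `k`-scheme `X`: the hypercohomology of the
algebraic de Rham complex `Ω•_{X/k}` (`Crystalline/DeRhamComplexSheaf.algebraicDeRhamComplex`), in
the tree's sense `Crystalline/SheafHypercohomology` (`ℍⁿ(K) = Hom_{D(Sh)}(ℤ, K⟦n⟧)`, Mathlib's sheaf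
cohomology `Sheaf.H` extended to complexes).

* `algebraicDeRhamComplexInt X` — `Ω•_{X/k}` as a `ℤ`-indexed cochain complex of abelian sheaves
  (Mathlib's `HomologicalComplex.extend` along `ComplexShape.embeddingUpNat`; zero in negative
  degrees), so that hypercohomology applies; it is strictly `≥ 0`, whence `HasHyperExt` holds.
* `algebraicDeRhamCohomology X n` (`n : ℤ`) — **`Hⁿ_dR(X/k) := ℍⁿ(X, Ω•_{X/k})`**, an abelian group
  (`k`-module structure not recorded, as for the tree's Hodge cohomology groups), vanishing for
  `n < 0` (`algebraicDeRhamCohomology_eq_zero_of_neg`).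

Sources: A. Grothendieck, *On the de Rham cohomology of algebraic varieties*, Publ. Math. IHÉS 29
(1966), 95–103 (definition as hypercohomology of `Ω•_{X/k}`, p. 95); R. Hartshorne, *On the de Rham
cohomology of algebraic varieties*, Publ. Math. IHÉS 45 (1975), Ch. II §1; R. Hartshorne,
*Algebraic Geometry* (1977), III.7 p. 225; The Stacks project, Tag 0FM0. [folklore]
Everything here is a definition over proved constructions; no named facts. NOT here: the Hodge
filtration and the Hodge-to-de Rham spectral sequence `E₁ᵃᵇ = Hᵇ(X, Ωᵃ) ⇒ Hᵃ⁺ᵇ_dR`, finiteness and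
base change, the comparison with singular cohomology over `ℂ` (`Motives/DeRhamComparison` names it
abstractly) and with the affine model `Motives/AffineAlgebraicDeRham`, functoriality in `X`.
-/

noncomputable section

namespace Literature.AlgebraicGeometry.Crystalline

open CategoryTheory _root_.AlgebraicGeometry _root_.TopologicalSpace

universe u

variable {k : Type u} [CommRing k] (X : Over (Spec (CommRingCat.of k)))

/-- The algebraic de Rham complex `Ω•_{X/k}` as a `ℤ`-indexed cochain complex of abelian sheaves on
`X` (extension by zero in negative degrees of `algebraicDeRhamComplex X`). [folklore] -/
abbrev algebraicDeRhamComplexInt :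
    CochainComplex (Sheaf (Opens.grothendieckTopology X.left) AddCommGrpCat.{u}) ℤ :=
  (algebraicDeRhamComplex X).extend ComplexShape.embeddingUpNat

/-- `Ω•_{X/k}` (as a `ℤ`-indexed complex) is strictly concentrated in degrees `≥ 0`. [folklore] -/
instance : (algebraicDeRhamComplexInt X).IsStrictlyGE 0 := inferInstance

/-- **Algebraic de Rham cohomology** `Hⁿ_dR(X/k) := ℍⁿ(X, Ω•_{X/k})` of the `k`-scheme `X`
(`n : ℤ`): the hypercohomology (`Crystalline/SheafHypercohomology`, i.e. `Hom_{D(Sh(X))}(ℤ, Ω•⟦n⟧)`)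
of the algebraic de Rham complex of sheaves of abelian groups `𝒪_X → Ω¹_{X/k} → Ω²_{X/k} → ⋯`.
(Grothendieck 1966, p. 95; Hartshorne 1975, II §1; Stacks 0FM0.) [folklore] -/
def algebraicDeRhamCohomology (n : ℤ) : Type u :=
  SheafHypercohomology.{u} (Opens.grothendieckTopology X.left) (algebraicDeRhamComplexInt X) n

/-- `Hⁿ_dR(X/k)` is an abelian group. [folklore] -/
instance (n : ℤ) : AddCommGroup (algebraicDeRhamCohomology X n) :=
  inferInstanceAs (AddCommGroup (SheafHypercohomology.{u} _ (algebraicDeRhamComplexInt X) n))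

/-- `Hⁿ_dR(X/k) = 0` for `n < 0`. [folklore] -/
theorem algebraicDeRhamCohomology_eq_zero_of_neg {n : ℤ} (hn : n < 0)
    (x : algebraicDeRhamCohomology X n) : x = 0 :=
  sheafHypercohomology_eq_zero_of_lt (algebraicDeRhamComplexInt X) 0 hn x

end Literature.AlgebraicGeometry.Crystalline

end
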